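import Summits.AnomalousDissipation.AnomalousDissipation.Theorems.BaireTransferRobustLoudUpgradeStubLsFamilyA
import Summits.AnomalousDissipation.AnomalousDissipation.Theorems.BaireTransferRobustLoudUpgradeStubLsFamilyPhase
import Literature.Analysis.Calculus.BorderedImplicitFamily
import Literature.Analysis.FunctionSpaces.TorusClassicalNSUniqueness

/-!
# Stub `stub_lsFamily` of the line `malkin-cone-group-orbits` (crux stmt-AnomalousDissipation-1144, companion c2),
# part B: the LYAPUNOV–SCHMIDT FAMILY of a simply degenerate steady state, bordered by an external admissible field

Registered stub `stub_lsFamily` (Pi-form), proved here.  Let `u₀` be a mean-zero classical steady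
state of `NS_ν(f_c)` (`ν > 0`), `v` a smooth divergence-free mean-zero real field whose complex line contains the
classical mean-zero kernel of the linearisation `L(ν,u₀)`, and `h` a smooth divergence-free mean-zero real field with
`h ∉ range L(ν,u₀)`.  On the steady Fourier lattice (state space `W`, steady map `G(x) = 4π²ν x + B(x,x)`, force map
`Fm`, exactly as in `…StubMalkinBorderedA.lean`, whose `exists_bordered_correction` is the template of this file) the
derivative `T = DG(x₀)` is a compact perturbation of `4π²ν·1` with `ker T ⊆ ℝ·g`, `g` the state vector of `v`
(kernel transfer through `SteadyLattice.exists_linNSResolventRel_of_latticeEq` and reality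
`eq_re_smul_of_isConjSymm`), and the coefficient vector `e` of `h` satisfies `−e ∉ range T` (range transfer, by
visibility of `h`).  The abstract `Literature.Analysis.Calculus.malkin_implicit_family` — run with parameter space
`P_S`, border `−e`, and the PHASE FUNCTIONAL `φ = ∫⟪v, ·⟫` of `…StubLsFamilyPhase.lean` (`φ g = ∫‖v‖² ≠ 0`) — yields
`σ, υ` on `P_S × ℝ` with `G(υ q) = Fm q.1 − σ q • e`, `φ(υ q − x₀) = q.2`, local uniqueness, and the first-order
tests `Dσ(c,0)(0,1) = 0`, `Dσ(c,0)(d,0) = 0 ↔ Fm d ∈ range T`.  The states `υ q` are classical steady states of the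
corrected forces `f_{q.1} − σ q h` (`SteadyLattice.exists_steadyState_of_latticeEq`), `H¹`- and lattice-close to
`u₀` (`h1_le_of_coeff`, `latticeDist_eq_norm_sq`), of phase `∫⟪v, u' − u₀⟫ = q.2`; uniqueness transfers to
classical steady states through their state vectors (`fourier_eq_of_isSteadyNSState`).  Pure proof file.
References: Chow–Hale 1982 §2.4 and Ch. 6; Vanderbauwhede 1982 Ch. 8; Kielhöfer 2012 §I.2; Temam 1979 Ch. II §1.
-/

-- `Summit.<Summit>.<Problem>` is the tree's mandated summit-side namespace (CONVENTIONS §2); for this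
-- single-conjunct summit the two coincide, so the duplicate is deliberate.
set_option linter.dupNamespace false

noncomputable section

open scoped BigOperators Topology ENNReal NNReal InnerProductSpace ComplexConjugate
open Filter Set Function TopologicalSpace MeasureTheory UnitAddTorus

namespace Summit.AnomalousDissipation.AnomalousDissipation.Theorems.RobustLoudUpgrade.LsFamily

open Literature.Analysis.FunctionSpaces Literature.Analysis.FunctionSpaces.Torus
open Literature.Analysis.FunctionSpaces.EuclideanSpace
open Literature.Analysis.FluidPDE
open Literature.Analysis.FluidPDE.ScalarFourier
open Literature.Analysis.FluidPDE.SteadyLattice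
open Literature.Analysis.Calculus
open Summit.AnomalousDissipation.AnomalousDissipation.Theses.BaireTransfer
open Summit.AnomalousDissipation.AnomalousDissipation.Theorems.RobustLoudUpgrade.SteadyPersist

section Family

set_option maxHeartbeats 1600000 in
/-- **Registered stub `stub_lsFamily`: the Lyapunov–Schmidt family of a simply degenerate steady state, bordered by
an external admissible field** (Chow–Hale 1982 §2.4/Ch. 6, Vanderbauwhede 1982 Ch. 8, Kielhöfer 2012 §I.2), classical
formulation: see the module docstring. [folklore] -/
theorem stub_lsFamily :
    ∀ (S : Finset (Fin 3 → ℤ)) (c : Coeff S) (ν : ℝ) (u₀ : UnitAddTorus (Fin 3) → EuclideanSpace ℝ (Fin 3))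
      (p₀ : UnitAddTorus (Fin 3) → ℝ) (v h : UnitAddTorus (Fin 3) → EuclideanSpace ℝ (Fin 3)),
      0 < ν → Torus.IsSteadyNSState ν (force S c) u₀ p₀ → HasZeroMean u₀ →
      IsSmooth v → IsDivFree v → HasZeroMean v →
      (∀ w, Torus.LinNSResolventRel ν u₀ 0 w 0 → ∃ z : ℂ, w = z • cplx v) →
      IsSmooth h → IsDivFree h → HasZeroMean h →
      (∀ w, ¬ Torus.LinNSResolventRel ν u₀ 0 w (cplx h)) →
      ∃ σ : Coeff S × ℝ → ℝ, σ (c, 0) = 0 ∧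
        (∃ ℓ : Coeff S × ℝ →L[ℝ] ℝ, HasFDerivAt σ ℓ (c, 0) ∧ ℓ (0, 1) = 0 ∧
          ∀ d : Coeff S, (∀ w, ¬ Torus.LinNSResolventRel ν u₀ 0 w (cplx (force S d))) → ℓ (d, 0) ≠ 0) ∧
        (∀ δ : ℝ, 0 < δ → ∃ r : ℝ, 0 < r ∧ ContinuousOn σ (Metric.ball (c, (0 : ℝ)) r) ∧
          ∀ q ∈ Metric.ball (c, (0 : ℝ)) r, |σ q| < δ ∧
            ∃ (u' : UnitAddTorus (Fin 3) → EuclideanSpace ℝ (Fin 3)) (p' : UnitAddTorus (Fin 3) → ℝ),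
              Torus.IsSteadyNSState ν (fun y => force S q.1 y - σ q • h y) u' p' ∧ HasZeroMean u' ∧
                h1DistSq u' u₀ < δ ∧
                (∑' k : Fin 3 → ℤ, freqNormSq k ^ 2 *
                    ‖mFourierCoeff (complexify ∘ u') k - mFourierCoeff (complexify ∘ u₀) k‖ ^ 2) < δ ∧
                (∫ y, inner ℝ (v y) (u' y - u₀ y)) = q.2) ∧
        ∃ ρ : ℝ, 0 < ρ ∧ ∀ (c' : Coeff S) (x t : ℝ) (u'' : UnitAddTorus (Fin 3) → EuclideanSpace ℝ (Fin 3))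
          (p'' : UnitAddTorus (Fin 3) → ℝ),
          dist c' c < ρ → |x| < ρ → |t| < ρ →
          Torus.IsSteadyNSState ν (fun y => force S c' y - t • h y) u'' p'' → HasZeroMean u'' →
          (∑' k : Fin 3 → ℤ, freqNormSq k ^ 2 *
              ‖mFourierCoeff (complexify ∘ u'') k - mFourierCoeff (complexify ∘ u₀) k‖ ^ 2) < ρ →
          (∫ y, inner ℝ (v y) (u'' y - u₀ y)) = x → t = σ (c', x) := by
  intro S c ν u₀ p₀ v h hν hst h0 hv₁ hv₂ hv₃ hker hh₁ hh₂ hh₃ hvis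
  -- §1 the unperturbed state on the Fourier side (verbatim from the template)
  have hu₀ : IsSmooth u₀ := hst.smooth_velocity.isSmooth_slice (Set.mem_univ 0)
  have hdiv₀ : IsDivFree u₀ := hst.divFree 0 (Set.mem_univ 0)
  set a : (Fin 3 → ℤ) → (EuclideanSpace ℂ (Fin 3)) := mFourierCoeff (complexify ∘ u₀) with ha
  have har : RapidDecay a := hu₀.complexify_comp.rapidDecay_mFourierCoeff
  have ha0 : a 0 = 0 := mFourierCoeff_complexify_zero_of_hasZeroMean hu₀ h0
  -- §2 the state space, the bilinear map, the force map
  obtain ⟨W, hW, hWc⟩ := exists_space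
  haveI : CompleteSpace W := completeSpace_W hWc
  obtain ⟨B, hB, hBb⟩ := exists_bilinear hW
  obtain ⟨Fm, hFm⟩ := exists_forceMap (S := S) hW
  -- §3 the base point `x₀`, the kernel vector `g`, the coefficient vector `e` of the border field
  obtain ⟨x₀, hcf⟩ := exists_stateVec hW hu₀ hdiv₀ h0
  obtain ⟨g, hg⟩ := exists_stateVec hW hv₁ hv₂ hv₃
  obtain ⟨e, he⟩ := exists_coeffVec hW hh₁ hh₂ hh₃
  -- §4 the steady map and its derivative (verbatim from the template)
  set cν : ℝ := 4 * Real.pi ^ 2 * ν with hcν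
  have hcν0 : cν ≠ 0 := by positivity
  set G : W → W := fun x => cν • x + B x x with hG
  set K : W →L[ℝ] W := (hBb.deriv (x₀, x₀)).comp ((ContinuousLinearMap.id ℝ W).prod (ContinuousLinearMap.id ℝ W))
    with hK
  have hKw : ∀ w, K w = B x₀ w + B w x₀ := fun w => by simp [hK, IsBoundedBilinearMap.deriv_apply]
  have hGd : HasStrictFDerivAt G (cν • ContinuousLinearMap.id ℝ W + K) x₀ := hasStrictFDerivAt_steadyMap hBb cν x₀
  have hKc : IsCompactOperator K := isCompactOperator_linearised hWc hB x₀ (by rw [hcf]; exact har) K hKw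
  have hGcd : ContDiffAt ℝ 1 G x₀ := by
    have h1 : ContDiff ℝ 1 (fun x : W => cν • x) := contDiff_id.const_smul cν
    have h2 : ContDiff ℝ 1 (fun x : W => B x x) :=
      (hBb.contDiff (n := 1)).comp (contDiff_id.prodMk contDiff_id)
    exact (h1.add h2).contDiffAt
  -- coordinates of `G`
  have hGcoe : ∀ x : W, (((G x : W) : (lp (fun _ : Fin 3 → ℤ => EuclideanSpace ℂ (Fin 3)) 2)) : (Fin 3 → ℤ) →
      (EuclideanSpace ℂ (Fin 3))) = fun k => ((cν : ℝ) : ℂ) • ((x : (lp (fun _ : Fin 3 → ℤ => EuclideanSpace ℂ (Fin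
      3)) 2)) : (Fin 3 → ℤ) → (EuclideanSpace ℂ (Fin 3))) k +
      Torus.lerayCoeff k ((WithLp.toLp 2 (fun pp : Fin 3 => transportSym (fun jj mm => (((fun mm : Fin 3 →
          ℤ => (((freqNormSq mm)⁻¹ : ℝ) : ℂ)) • (((x : (lp (fun _ : Fin 3 → ℤ => EuclideanSpace ℂ (Fin 3)) 2)) : (Fin
          3 → ℤ) → (EuclideanSpace ℂ (Fin 3))) : (Fin 3 → ℤ) → EuclideanSpace ℂ (Fin 3)))) mm jj) (fun mm => (((fun
          mm : Fin 3 → ℤ => (((freqNormSq mm)⁻¹ : ℝ) : ℂ)) • (((x : (lp (fun _ : Fin 3 → ℤ => EuclideanSpace ℂ (Fin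
          3)) 2)) : (Fin 3 → ℤ) → (EuclideanSpace ℂ (Fin 3))) : (Fin 3 → ℤ) → EuclideanSpace ℂ (Fin 3)))) mm pp) k) :
          EuclideanSpace ℂ (Fin 3))) := by
    intro x
    rw [hG]
    dsimp only
    rw [coeW_add, coeW_smul, hB]
    funext k
    simp only [Pi.add_apply, Pi.smul_apply, Complex.coe_smul]
  -- coordinates of the linearisation `T = cν·1 + K`
  set T : W →L[ℝ] W := cν • ContinuousLinearMap.id ℝ W + K with hT
  have hTw : ∀ w : W, T w = cν • w + K w := fun w => by simp [hT]
  have hTcoe : ∀ (w : W) (k : (Fin 3 → ℤ)), (((T w : W) : (lp (fun _ : Fin 3 → ℤ => EuclideanSpace ℂ (Fin 3)) 2)) :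
      (Fin 3 → ℤ) → (EuclideanSpace ℂ (Fin 3))) k =
      (((4 * Real.pi ^ 2 * ν : ℝ)) : ℂ) • ((w : (lp (fun _ : Fin 3 → ℤ => EuclideanSpace ℂ (Fin 3)) 2)) : (Fin 3 → ℤ)
          → (EuclideanSpace ℂ (Fin 3))) k +
        Torus.lerayCoeff k ((WithLp.toLp 2 (fun pp : Fin 3 => transportSym (fun jj mm => a mm jj) (fun mm => (((fun
            mm : Fin 3 → ℤ => (((freqNormSq mm)⁻¹ : ℝ) : ℂ)) • (((w : (lp (fun _ : Fin 3 → ℤ => EuclideanSpace ℂ (Fin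
            3)) 2)) : (Fin 3 → ℤ) → (EuclideanSpace ℂ (Fin 3))) : (Fin 3 → ℤ) → EuclideanSpace ℂ (Fin 3)))) mm pp)
            k) : EuclideanSpace ℂ (Fin 3)) + (WithLp.toLp 2 (fun pp : Fin 3 => transportSym (fun jj mm => (((fun mm :
            Fin 3 → ℤ => (((freqNormSq mm)⁻¹ : ℝ) : ℂ)) • (((w : (lp (fun _ : Fin 3 → ℤ => EuclideanSpace ℂ (Fin 3))
            2)) : (Fin 3 → ℤ) → (EuclideanSpace ℂ (Fin 3))) : (Fin 3 → ℤ) → EuclideanSpace ℂ (Fin 3)))) mm jj) (fun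
            mm => a mm pp) k) : EuclideanSpace ℂ (Fin 3))) := by
    intro w k
    rw [hTw, coeW_add, hKw, coeW_add, coeW_smul, hB, hB, hcf]
    simp only [Pi.add_apply, Pi.smul_apply]
    rw [← lerayCoeff_add', ← Complex.coe_smul]
  -- §5 lattice solutions of `T x = −Π ĝ` are classical solutions of `L(ν,u₀) w = g`
  have hsolveT : ∀ (x : W) (gf : (UnitAddTorus (Fin 3)) → (EuclideanSpace ℂ (Fin 3))), IsSmooth gf →
      mFourierCoeff gf 0 = 0 →
      (∀ k : (Fin 3 → ℤ), (((T x : W) : (lp (fun _ : Fin 3 → ℤ => EuclideanSpace ℂ (Fin 3)) 2)) : (Fin 3 → ℤ) →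
        (EuclideanSpace ℂ (Fin 3))) k = -Torus.lerayCoeff k (mFourierCoeff gf k)) →
      ∃ w, Torus.LinNSResolventRel ν u₀ 0 w gf ∧ mFourierCoeff w = ((fun mm : Fin 3 → ℤ => (((freqNormSq mm)⁻¹ :
        ℝ) : ℂ)) • (((x : (lp (fun _ : Fin 3 → ℤ => EuclideanSpace ℂ (Fin 3)) 2)) : (Fin 3 → ℤ) → (EuclideanSpace ℂ
        (Fin 3))) : (Fin 3 → ℤ) → EuclideanSpace ℂ (Fin 3))) := by
    intro x gf hgs hg0 hco
    exact exists_linNSResolventRel_of_latticeEq hν hu₀ hdiv₀ hgs hg0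
      (x : (lp (fun _ : Fin 3 → ℤ => EuclideanSpace ℂ (Fin 3)) 2)) (W_zero hW x) (W_trans hW x)
      (fun k => by rw [← hTcoe]; exact hco k)
  have hcplx : ∀ u : (UnitAddTorus (Fin 3)) → (EuclideanSpace ℝ (Fin 3)), cplx u = complexify ∘ u := fun u => by
    funext y; simp only [cplx, Function.comp_apply, realToComplex_eq_complexify]
  -- kernel transfer: `T x = 0 ⇒ x ∈ ℝ·g`
  have hVcs : IsConjSymm (mFourierCoeff (complexify ∘ v)) := isConjSymm_mFourierCoeff hv₁.integrable
  have hkerT : ∀ x : W, T x = 0 → ∃ z : ℝ, x = z • g := by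
    intro x hx
    have hz : ∀ k, mFourierCoeff (0 : (UnitAddTorus (Fin 3)) → (EuclideanSpace ℂ (Fin 3))) k = 0 := fun k => by
      rw [show (0 : (UnitAddTorus (Fin 3)) → (EuclideanSpace ℂ (Fin 3))) = (0 : ℂ) • (0 : (UnitAddTorus (Fin 3)) →
          (EuclideanSpace ℂ (Fin 3))) by simp, mFourierCoeff_const_smul, zero_smul]
    obtain ⟨w, hrel, hŵ⟩ := hsolveT x 0 (isSmooth_const (0 : (EuclideanSpace ℂ (Fin 3)))) (hz 0) (fun k => by
      rw [hx, Submodule.coe_zero, hz, lerayCoeff_zero_vec, neg_zero]; rfl)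
    obtain ⟨z, hwz⟩ := hker w hrel
    have hcfx : ∀ k, (((fun mm : Fin 3 → ℤ => (((freqNormSq mm)⁻¹ : ℝ) : ℂ)) • (((x : (lp (fun _ : Fin 3 →
        ℤ => EuclideanSpace ℂ (Fin 3)) 2)) : (Fin 3 → ℤ) → (EuclideanSpace ℂ (Fin 3))) : (Fin 3 → ℤ) → EuclideanSpace
        ℂ (Fin 3)))) k = z • mFourierCoeff (complexify ∘ v) k := by
      intro k
      rw [← hŵ, hwz, hcplx, mFourierCoeff_const_smul]
    have hre := eq_re_smul_of_isConjSymm (isConjSymm_cf (W_conj hW x)) hVcs hcfx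
    refine ⟨z.re, Subtype.ext (lp.ext ?_)⟩
    refine eq_of_cf_eq (W_zero hW x) (W_zero hW (z.re • g)) ?_
    rw [coeW_smul, cf_real_smul, hg]
    funext k
    rw [hre k, Pi.smul_apply]
  -- §6 range transfer: `T x ≠ −Fm d` for a visible force direction, `T x ≠ −e` for the visible border field
  set FmL : Coeff S →L[ℝ] W := LinearMap.toContinuousLinearMap Fm with hFmL
  have hFmL : ∀ d, FmL d = Fm d := fun d => rfl
  have hrangeF : ∀ d : Coeff S, (∀ w, ¬ Torus.LinNSResolventRel ν u₀ 0 w (cplx (force S d))) →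
      ∀ x : W, T x ≠ (-FmL) d := by
    intro d hvisd x hx
    obtain ⟨w, hrel, -⟩ := hsolveT x (complexify ∘ force S d) (isSmooth_force' d).complexify_comp
      (mFourierCoeff_complexify_zero_of_hasZeroMean (isSmooth_force' d) (hasZeroMean_force' d)) (fun k => by
        rw [hx, neg_apply, hFmL, Submodule.coe_neg, lp.coeFn_neg, Pi.neg_apply, hFm, lerayCoeff_forceCoeff])
    exact hvisd w (by rw [hcplx]; exact hrel)
  have hrangeT : ∀ x : W, T x ≠ -e := by
    intro x hx
    obtain ⟨w, hrel, -⟩ := hsolveT x (complexify ∘ h) hh₁.complexify_comp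
      (mFourierCoeff_complexify_zero_of_hasZeroMean hh₁ hh₃) (fun k => by
        rw [hx, Submodule.coe_neg, lp.coeFn_neg, Pi.neg_apply, he, lerayCoeff_coeff hh₁ hh₂ hh₃])
    exact hvis w (by rw [hcplx]; exact hrel)
  -- §7 the isomorphism `J = cν·1`, compactness of `T − J = K`, and: `T` is not injective
  set J : W ≃L[ℝ] W := ContinuousLinearEquiv.equivOfInverse (cν • ContinuousLinearMap.id ℝ W)
    (cν⁻¹ • ContinuousLinearMap.id ℝ W)
    (fun x => by
      change cν⁻¹ • (cν • x) = x
      rw [smul_smul, inv_mul_cancel₀ hcν0, one_smul])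
    (fun x => by
      change cν • (cν⁻¹ • x) = x
      rw [smul_smul, mul_inv_cancel₀ hcν0, one_smul]) with hJ
  have hTJ : (T - (J : W →L[ℝ] W) : W →L[ℝ] W) = K := by
    ext w
    simp [hT, hJ]
  have hKTJ : IsCompactOperator (T - (J : W →L[ℝ] W) : W →L[ℝ] W) := by rw [hTJ]; exact hKc
  have hJ0 : ∀ _hinj : Injective T, False := by
    intro hinj
    obtain ⟨x, hx⟩ := (bijective_of_injective_of_isCompactOperator T J hKTJ hinj).2 (-e)
    exact hrangeT x hx
  -- §8 the phase functional `φ = ∫⟪v, ·⟫` and `φ g ≠ 0`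
  obtain ⟨φ₀, hφ₀⟩ := lsFamily_phaseFunctional v hv₁
  set φ : W →L[ℝ] ℝ := φ₀.comp W.subtypeL with hφ
  have hφw : ∀ x : W, φ x = φ₀ (x : (lp (fun _ : Fin 3 → ℤ => EuclideanSpace ℂ (Fin 3)) 2)) := fun x => rfl
  have hgne : g ≠ 0 := by
    intro hg0
    refine hJ0 ?_
    rw [injective_iff_map_eq_zero]
    intro x hx
    obtain ⟨z, rfl⟩ := hkerT x hx
    rw [hg0, smul_zero]
  have hvne : v ≠ 0 := by
    intro hv0
    apply hgne
    refine Subtype.ext (lp.ext ?_)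
    refine eq_of_cf_eq (W_zero hW g) (W_zero hW (0 : W)) ?_
    rw [hg, hv0, Submodule.coe_zero]
    funext k
    rw [cf_apply, lp.coeFn_zero, Pi.zero_apply, smul_zero]
    rw [show (complexify ∘ (0 : (UnitAddTorus (Fin 3)) → (EuclideanSpace ℝ (Fin 3)))) = (0 : ℂ) • (0 : (UnitAddTorus
        (Fin 3)) → (EuclideanSpace ℂ (Fin 3))) by funext y; simp, mFourierCoeff_const_smul, zero_smul]
  have hφg : φ g ≠ 0 := by
    rw [hφw, hφ₀ _ v hv₁ hg]
    intro hint
    have hint' : (∫ y, ‖v y‖ ^ 2) ≤ 0 := by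
      have e : (fun y => inner ℝ (v y) (v y)) = fun y => ‖v y‖ ^ 2 := by
        funext y; rw [real_inner_self_eq_norm_sq]
      rw [e] at hint
      exact hint.le
    exact hvne (eq_zero_of_integral_norm_sq_nonpos hv₁ hint')
  -- §9 the base equation and the abstract Lyapunov–Schmidt family
  have heq₀ : ∀ k : (Fin 3 → ℤ), (((ν * (4 * Real.pi ^ 2 * freqNormSq k)) : ℝ) : ℂ) • a k + Torus.lerayCoeff k
      ((WithLp.toLp 2 (fun pp : Fin 3 => transportSym (fun jj mm => a mm jj) (fun mm => a mm pp) k) : EuclideanSpace ℂ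
      (Fin 3))) =
      mFourierCoeff (complexify ∘ force S c) k := fun k => by
    rw [ha, fourier_eq_of_isSteadyNSState hst (isSmooth_force' c) h0 k, lerayCoeff_forceCoeff]
  have hGx₀ : G x₀ = Fm c := by
    refine Subtype.ext (lp.ext (funext fun k => ?_))
    rw [hGcoe, hFm]
    dsimp only
    rw [smul_eq_weight_smul_cf (W_zero hW x₀) k, hcf]
    exact heq₀ k
  have h00 : G x₀ + (-FmL) c = 0 := by
    rw [neg_apply, hFmL, hGx₀, add_neg_cancel]
  obtain ⟨σ, υ, ℓ, r, hr, hσ0, hυ0, hσℓ, hσd, hυd, hℓ01, hℓd, hσc, -, hsol, huniq⟩ :=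
    malkin_implicit_family G (-FmL) T J φ x₀ g c (-e) hGcd hGd.hasFDerivAt h00 hKTJ hkerT hrangeT hφg
  -- bookkeeping shared by the family clause and the uniqueness clause: a lattice solution of the corrected equation
  -- is a classical steady state of the corrected force
  have hforceEq : ∀ (x : W) (c' : Coeff S) (t : ℝ), G x = Fm c' - t • e → ∀ k : (Fin 3 → ℤ),
      (((4 * Real.pi ^ 2 * ν : ℝ)) : ℂ) • ((x : (lp (fun _ : Fin 3 → ℤ => EuclideanSpace ℂ (Fin 3)) 2)) : (Fin 3 → ℤ)
        → (EuclideanSpace ℂ (Fin 3))) k +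
      Torus.lerayCoeff k ((WithLp.toLp 2 (fun pp : Fin 3 => transportSym (fun jj mm => (((fun mm : Fin 3 →
          ℤ => (((freqNormSq mm)⁻¹ : ℝ) : ℂ)) • (((x : (lp (fun _ : Fin 3 → ℤ => EuclideanSpace ℂ (Fin 3)) 2)) : (Fin
          3 → ℤ) → (EuclideanSpace ℂ (Fin 3))) : (Fin 3 → ℤ) → EuclideanSpace ℂ (Fin 3)))) mm jj) (fun mm => (((fun
          mm : Fin 3 → ℤ => (((freqNormSq mm)⁻¹ : ℝ) : ℂ)) • (((x : (lp (fun _ : Fin 3 → ℤ => EuclideanSpace ℂ (Fin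
          3)) 2)) : (Fin 3 → ℤ) → (EuclideanSpace ℂ (Fin 3))) : (Fin 3 → ℤ) → EuclideanSpace ℂ (Fin 3)))) mm pp) k) :
          EuclideanSpace ℂ (Fin 3))) =
      mFourierCoeff (complexify ∘ fun y => force S c' y - t • h y) k := by
    intro x c' t hGx k
    have h1 := congrArg (fun z : W => (((z : W) : (lp (fun _ : Fin 3 → ℤ => EuclideanSpace ℂ (Fin 3)) 2)) : (Fin 3 → ℤ)
        → (EuclideanSpace ℂ (Fin 3))) k) hGx
    dsimp only at h1
    rw [hGcoe, coeW_sub, coeW_smul, Pi.sub_apply, Pi.smul_apply, hFm, he, ← Complex.coe_smul] at h1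
    rw [mFourierCoeff_sub_smul (isSmooth_force' _) hh₁]
    exact h1
  refine ⟨σ, hσ0, ⟨ℓ, hσℓ, hℓ01, fun d hvisd hℓd0 => ?_⟩, fun δ hδ => ?_, ?_⟩
  · -- first-order visibility of a force direction
    obtain ⟨w, hw⟩ := (hℓd d).1 hℓd0
    exact hrangeF d hvisd w hw
  · -- §10 the family clause: radii from continuity of `υ` and `σ` at `(c, 0)`
    set δ' : ℝ := min 1 (δ / (2 * (1 + 4 * Real.pi ^ 2))) with hδ'
    have hδ'0 : 0 < δ' := lt_min one_pos (by positivity)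
    have hδ'1 : δ' ≤ 1 := min_le_left _ _
    have hδ'2 : δ' ≤ δ / (2 * (1 + 4 * Real.pi ^ 2)) := min_le_right _ _
    have hpi : (0 : ℝ) < 1 + 4 * Real.pi ^ 2 := by positivity
    have hδ'3 : δ' < δ := by
      refine lt_of_le_of_lt hδ'2 ?_
      rw [div_lt_iff₀ (by positivity)]
      nlinarith
    obtain ⟨r₁, hr₁, hball₁⟩ := Metric.continuousAt_iff.1 hυd.continuousAt δ' hδ'0
    obtain ⟨r₂, hr₂, hball₂⟩ := Metric.continuousAt_iff.1 hσd.continuousAt δ hδ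
    refine ⟨min r (min r₁ r₂), lt_min hr (lt_min hr₁ hr₂),
      hσc.mono (Metric.ball_subset_ball (min_le_left _ _)), fun q hq => ?_⟩
    have hqr : q ∈ Metric.ball ((c, 0) : Coeff S × ℝ) r := Metric.ball_subset_ball (min_le_left _ _) hq
    have hq₁ : dist q (c, 0) < r₁ := lt_of_lt_of_le (Metric.mem_ball.1 hq) ((min_le_right _ _).trans (min_le_left _ _))
    have hq₂ : dist q (c, 0) < r₂ :=
      lt_of_lt_of_le (Metric.mem_ball.1 hq) ((min_le_right _ _).trans (min_le_right _ _))
    have hσq : |σ q| < δ := by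
      have := hball₂ hq₂
      rwa [hσ0, Real.dist_eq, sub_zero] at this
    refine ⟨hσq, ?_⟩
    set x : W := υ q with hxdef
    have hGx : G x = Fm q.1 - σ q • e := by
      have h1 := (hsol q hqr).1
      rw [neg_apply, hFmL, smul_neg, sub_neg_eq_add] at h1
      rw [← sub_eq_zero, ← h1]
      abel
    have hFs : IsSmooth (fun y => force S q.1 y - σ q • h y) := isSmooth_sub_smul (isSmooth_force' _) hh₁ _
    have hFd : IsDivFree (fun y => force S q.1 y - σ q • h y) :=
      isDivFree_sub_smul (isSmooth_force' _) hh₁ (isDivFree_force' _) hh₂ _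
    have hF0 : HasZeroMean (fun y => force S q.1 y - σ q • h y) :=
      hasZeroMean_sub_smul (isSmooth_force' _) hh₁ (hasZeroMean_force' _) hh₃ _
    obtain ⟨u', p', hst', hmean', hu', hû'⟩ := exists_steadyState_of_latticeEq hν hFs hFd hF0
      (x : (lp (fun _ : Fin 3 → ℤ => EuclideanSpace ℂ (Fin 3)) 2)) (W_zero hW x) (W_trans hW x) (W_conj hW x)
      (hforceEq x q.1 (σ q) hGx)
    refine ⟨u', p', hst', hmean', ?_, ?_, ?_⟩
    · -- the `H¹` estimate (verbatim from the template)
      set z : W := x - x₀ with hz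
      have hzn : ‖z‖ < δ' := by
        rw [hz, ← dist_eq_norm]
        have := hball₁ hq₁
        rwa [hυ0] at this
      have hvd : IsSmooth (fun y => u' y - u₀ y) := hu'.sub hu₀
      have hcoefv := cf_sub_eq hu' hu₀ x x₀ hû'.symm hcf
      have hH := h1_le_of_coeff hvd (z : (lp (fun _ : Fin 3 → ℤ => EuclideanSpace ℂ (Fin 3)) 2)) hcoefv
      rw [norm_coeW] at hH
      change (∫ y, ‖u' y - u₀ y‖ ^ 2) + gradNormSq (fun y => u' y - u₀ y) < δ
      have hzle : ‖z‖ ≤ δ' := hzn.le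
      have hz2 : ‖z‖ ^ 2 ≤ δ' * δ' := by
        rw [sq]
        exact mul_le_mul hzle hzle (norm_nonneg z) ((norm_nonneg z).trans hzle)
      have hd : δ' * δ' ≤ δ' := mul_le_of_le_one_left hδ'0.le hδ'1
      calc (∫ y, ‖u' y - u₀ y‖ ^ 2) + gradNormSq (fun y => u' y - u₀ y) ≤ (1 + 4 * Real.pi ^ 2) * ‖z‖ ^ 2 := hH
        _ ≤ (1 + 4 * Real.pi ^ 2) * δ' := mul_le_mul_of_nonneg_left (hz2.trans hd) hpi.le
        _ ≤ (1 + 4 * Real.pi ^ 2) * (δ / (2 * (1 + 4 * Real.pi ^ 2))) := mul_le_mul_of_nonneg_left hδ'2 hpi.le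
        _ = δ / 2 := by field_simp
        _ < δ := half_lt_self hδ
    · -- the lattice estimate
      rw [latticeDist_eq_norm_sq hW hu' hu₀ x x₀ hû'.symm hcf]
      have hzn : ‖x - x₀‖ < δ' := by
        rw [← dist_eq_norm]
        have := hball₁ hq₁
        rwa [hυ0] at this
      have h2 : ‖x - x₀‖ ^ 2 ≤ δ' * δ' := by
        rw [sq]
        exact mul_le_mul hzn.le hzn.le (norm_nonneg _) ((norm_nonneg _).trans hzn.le)
      have hd : δ' * δ' ≤ δ' := mul_le_of_le_one_left hδ'0.le hδ'1
      exact lt_of_le_of_lt (h2.trans hd) hδ'3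
    · -- the phase
      have h1 := (hsol q hqr).2
      rw [hφw] at h1
      have hcoefv := cf_sub_eq hu' hu₀ x x₀ hû'.symm hcf
      rw [hφ₀ _ (fun y => u' y - u₀ y) (hu'.sub hu₀) hcoefv.symm] at h1
      exact h1
  · -- §11 the uniqueness clause, transferred to classical steady states
    refine ⟨min r (r ^ 2), lt_min hr (by positivity), ?_⟩
    intro c' x t u'' p'' hc' hx ht hst'' hm'' hlat hph
    have hρr : min r (r ^ 2) ≤ r := min_le_left _ _
    have hu'' : IsSmooth u'' := hst''.smooth_velocity.isSmooth_slice (Set.mem_univ 0)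
    have hdiv'' : IsDivFree u'' := hst''.divFree 0 (Set.mem_univ 0)
    obtain ⟨x'', hcf''⟩ := exists_stateVec hW hu'' hdiv'' hm''
    have hFs : IsSmooth (fun y => force S c' y - t • h y) := isSmooth_sub_smul (isSmooth_force' _) hh₁ _
    have hFd : IsDivFree (fun y => force S c' y - t • h y) :=
      isDivFree_sub_smul (isSmooth_force' _) hh₁ (isDivFree_force' _) hh₂ _
    have hF0 : HasZeroMean (fun y => force S c' y - t • h y) :=
      hasZeroMean_sub_smul (isSmooth_force' _) hh₁ (hasZeroMean_force' _) hh₃ _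
    have heq'' : ∀ k : (Fin 3 → ℤ), (((ν * (4 * Real.pi ^ 2 * freqNormSq k)) : ℝ) : ℂ) • mFourierCoeff (complexify ∘
        u'') k + Torus.lerayCoeff k ((WithLp.toLp 2 (fun pp : Fin 3 => transportSym (fun jj mm => (mFourierCoeff
        (complexify ∘ u'')) mm jj) (fun mm => (mFourierCoeff (complexify ∘ u'')) mm pp) k) : EuclideanSpace ℂ (Fin 3))) =
        mFourierCoeff (complexify ∘ fun y => force S c' y - t • h y) k := fun k => by
      rw [fourier_eq_of_isSteadyNSState hst'' hFs hm'' k, lerayCoeff_coeff hFs hFd hF0]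
    have hGx'' : G x'' = Fm c' - t • e := by
      refine Subtype.ext (lp.ext (funext fun k => ?_))
      rw [hGcoe, coeW_sub, coeW_smul, hFm, he]
      dsimp only
      rw [smul_eq_weight_smul_cf (W_zero hW x'') k, hcf'', heq'' k, Pi.sub_apply, Pi.smul_apply,
        mFourierCoeff_sub_smul (isSmooth_force' _) hh₁, Complex.coe_smul]
    have hN'' : G x'' + (-FmL) c' - t • (-e) = 0 := by
      rw [hGx'', neg_apply, hFmL, smul_neg, sub_neg_eq_add]
      abel
    have hdist : dist x'' x₀ < r := by
      rw [dist_eq_norm]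
      have hsq : ‖x'' - x₀‖ ^ 2 < r ^ 2 := by
        rw [← latticeDist_eq_norm_sq hW hu'' hu₀ x'' x₀ hcf'' hcf]
        exact lt_of_lt_of_le hlat (min_le_right _ _)
      exact lt_of_pow_lt_pow_left₀ 2 hr.le hsq
    have hphase : φ (x'' - x₀) = ((c', x) : Coeff S × ℝ).2 := by
      rw [hφw, hφ₀ _ (fun y => u'' y - u₀ y) (hu''.sub hu₀) (cf_sub_eq hu'' hu₀ x'' x₀ hcf'' hcf).symm]
      exact hph
    have hq : ((c', x) : Coeff S × ℝ) ∈ Metric.ball ((c, 0) : Coeff S × ℝ) r := by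
      rw [Metric.mem_ball, Prod.dist_eq, Real.dist_eq, sub_zero]
      exact max_lt (hc'.trans_le hρr) (hx.trans_le hρr)
    exact (huniq (c', x) hq x'' t hdist (ht.trans_le hρr) hN'' hphase).1

end Family

end Summit.AnomalousDissipation.AnomalousDissipation.Theorems.RobustLoudUpgrade.LsFamily
end
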